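import Literature.NumberTheory.Sieve.HeathBrownCubicFLSequencesA
import Literature.NumberTheory.Sieve.HeathBrownCubicUpperBoundTools
import Mathlib.Analysis.Complex.Exponential
import HarnessLib

/-!
# Heath-Brown's Lemma 3.5, IV: the chain sums `Σ₀`, `Σ₁` (pp. 38–39)

Fourth file of the proof of the named fact `HeathBrown2001_lemma_3_5`
(`HeathBrownCubicSieveDecomposition`; D. R. Heath-Brown, *Primes represented by `x³ + 2y³`*, Acta
Math. 186 (2001), Lemma 3.5, §6). The main terms produced by the Fundamental Lemma for `T^(n)(𝒜)` and
`T^(n)(ℬ)` carry the chain sums `Σ₀ = ∑ ρ₀(p_1⋯p_n)/(p_1⋯p_n)` ((6.3), p. 35) and — after the exact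
reduction of `HeathBrownCubicFLSequencesB` — `Σ₁ = ∑_{s} N(P_1⋯P_n)^{-1}` over the chains of prime
ideals of (3.1). This file PROVES the two facts about them used on pp. 38–39: they are close to each
other, and their totals over `n` are `≪ τ^{-1}` ("`Σ₀ ≪ (1/n!)(log τ^{-1} + O(1))^n` and similarly
`Σ₁`", p. 39). No named fact is introduced.

## Content (namespace `Literature.NumberTheory.Sieve.CubicSieve`), all proved

* `chainSumB X τ n` (`Σ₁(n)`), `chainSumA X τ n` (`Σ₀(n) = ∑_{t ∈ ratChains n} densA(∏t)`),
  `smallPrimesWeight` (`W₁ = ∑_{P ∈ 𝒫₀} N(P)^{-1}`), `esymmB` (the elementary symmetric sums `e_k` of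
  these weights); `chainSumB_le_pow_div_factorial` (`Σ₁(n) ≤ W₁^n/n!`, from the tree's
  `esymm_le_pow_div_factorial`), `sum_chainSumB_le_exp`, `sum_chainSumA_le_exp` (**totals `≤ e^{W₁}`**).
* `GoodChain` (all norms prime and distinct), `goodOver`, **`card_goodOver_eq`** (the good sets with
  norms `t` number `∏_{p∈t} ν_p`: `s ↦ ∏s` is a bijection onto the ideals of norm `∏t`), `goodChains`,
  `badChains`, `chainSumB_eq_good_add_bad`, **`chainSumBgood_eq`** (`Σ₁^good(n) = ∑_t (∏ν_p)/∏t`),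
  **`chainSumA_le_chainSumBgood_and`** (`Σ₀ ≤ Σ₁^good ≤ Σ₀ + nX^{-τ}Σ₁^good`: the comparison
  "`ρ₁(q) = ρ₀(q){1 + O(X^{-τ})}^n`" of p. 38 in our normalisation, `ρ₀(p)/p = ν_p/(p+1)` against `ν_p/p`).
* `sum_nonprime_chains_le`, `sum_tie_chains_le`, **`chainSumBbad_le`** (`Σ₁^bad(n) ≤ 6Y^{-1/3}e_{n−1} +
  18Y^{-1}e_{n−2}` for `8 ≤ Y < X^τ`: a bad chain has a member of non-prime norm or two members of equal
  norm — the terms removed in (6.5) and in `T^(n)(ℬ) − T_1^(n)(ℬ)`, p. 36 — via the tree's `sum_sel_le`,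
  `sum_sel₂_le`, `sum_inv_absNorm_nonprime_le`, `sum_inv_absNorm_pair_eq_le`).
* **`sum_abs_chainSumA_sub_chainSumB_le`**: `∑_{n<N} |Σ₀(n) − Σ₁(n)| ≤ e^{W₁}(W₁X^{-τ} + 12Y^{-1/3} + 54Y^{-1})`.
* **`exists_smallPrimesWeight_le`**: `W₁ ≤ log τ^{-1} + 3` once `X^τ ≥ 2^{10}`, `τ ≤ 1/2`, `τ log X ≥ 2C₁`
  (sharp Mertens for the degree-one primes, the tree's `exists_sum_normWt_window_le`; the others
  contribute `≤ 6/(X^τ/2)^{1/3}`), so that `e^{W₁} ≤ e³ τ^{-1}`.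

## References

* D. R. Heath-Brown, *Primes represented by `x³ + 2y³`*, Acta Math. 186 (2001), 1–84: (6.3) p. 35,
  (6.5)–(6.6) pp. 36–37, pp. 38–39 (`Σ₀`, `Σ₁`, the summation over `n`). [cite: HeathBrownActa2001, §6 pp. 38–39]

## Mathlib / tree search

Mathlib: `Real.sum_le_exp_of_nonneg`, `Finset.sum_fiberwise_of_maps_to`, `Finset.sum_comp`,
`Finset.card_nbij'`, `Nat.squarefree_mul_iff`, `Finset.card_le_one`. Tree: `HeathBrownCubicChainSums`
(`esymm_le_pow_div_factorial`, `esymm_nonneg`, `sum_sel_le`, `sum_sel₂_le`, `exists_sum_normWt_window_le`,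
`idealNormCount_prod_primes`), `HeathBrownCubicUpperBoundTools` (`mem_chains_iff`, `mem_smallPrimes_iff`,
`absNorm_prod`, `sum_inv_absNorm_nonprime_le`, `sum_inv_absNorm_pair_eq_le`, `sum_union_le_add`),
`HeathBrownCubicFLSequencesA` (`ratChains`, `densA_prod_primes`, `normEq`, `card_normEq`, `NormSimple` tools),
`HeathBrownCubicSieveSetup` (`card_absNorm_eq_prime_eq_cubeRootTwoCount`, `primeFactorsFinset`).
-/

noncomputable section

open Polynomial NumberField Finset Filter Topology
open scoped Nat

namespace Literature.NumberTheory.Sieve.CubicSieve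

open LFunctions.CubeRootTwoField CubicPrimes
open Literature.NumberTheory.LFunctions (idealNormCount)

/-! ### The chain sums `Σ₀(n)` (over `ℚ`) and `Σ₁(n)` (over `K`) -/

/-- **`Σ₁(n) = ∑_{s ∈ chains n} N(∏s)^{-1}`**: the chain sum of the main term of `T^(n)(ℬ)` (p. 37,
with `ρ₁(p_1⋯p_n)/(p_1⋯p_n)` replaced by `N(P_1⋯P_n)^{-1}` through the exact reduction of
`HeathBrownCubicFLSequencesB`). [cite: HeathBrownActa2001, §6 (6.6)] -/
def chainSumB (X τ : ℝ) (n : ℕ) : ℝ :=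
  ∑ s ∈ chains X τ n, ((Ideal.absNorm (∏ P ∈ s, P) : ℕ) : ℝ)⁻¹

/-- **`Σ₀(n) = ∑_{t ∈ ratChains n} ρ₀(∏t)/∏t`** ("`Σ₀ = ∑ ρ₀(p_1⋯p_n)/(p_1⋯p_n)`", (6.3), p. 35): the
chain sum of the main term of `T^(n)(𝒜)`. [cite: HeathBrownActa2001, §6 (6.3)] -/
def chainSumA (X τ : ℝ) (n : ℕ) : ℝ := ∑ t ∈ ratChains X τ n, densA (∏ p ∈ t, p)

/-- `Σ₁(n) ≥ 0`. [folklore] -/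
theorem chainSumB_nonneg (X τ : ℝ) (n : ℕ) : 0 ≤ chainSumB X τ n :=
  sum_nonneg fun _ _ => by positivity

/-- `Σ₀(n) ≥ 0`. [folklore] -/
theorem chainSumA_nonneg (X τ : ℝ) (n : ℕ) : 0 ≤ chainSumA X τ n :=
  sum_nonneg fun _ _ => densA_nonneg _

/-- The weight `N(∏s)^{-1} = ∏_{P ∈ s} N(P)^{-1}`. [folklore] -/
theorem inv_absNorm_prod_eq (s : Finset (Ideal (𝓞 K))) :
    ((Ideal.absNorm (∏ P ∈ s, P) : ℕ) : ℝ)⁻¹ = ∏ P ∈ s, ((Ideal.absNorm P : ℕ) : ℝ)⁻¹ := by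
  rw [absNorm_prod, Nat.cast_prod, prod_inv_distrib]

/-- **`W₁ = ∑_{X^τ ≤ N(P) < X^{1−τ}} N(P)^{-1}`**, the first power sum of the weights of `Σ₁`. [folklore] -/
def smallPrimesWeight (X τ : ℝ) : ℝ := ∑ P ∈ smallPrimes X τ, ((Ideal.absNorm P : ℕ) : ℝ)⁻¹

/-- `W₁ ≥ 0`. [folklore] -/
theorem smallPrimesWeight_nonneg (X τ : ℝ) : 0 ≤ smallPrimesWeight X τ :=
  sum_nonneg fun _ _ => by positivity

/-- **`Σ₁(n) ≤ e_n ≤ W₁^n/n!`**: the chains are among the `n`-subsets of `𝒫₀` (dropping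
`N(∏s) < X^{1+τ}`), and `n! e_n ≤ p_1^n` ("`Σ₁ ≪ (1/n!)(log τ^{-1} + O(1))^n`", p. 39).
[cite: HeathBrownActa2001, §6 p. 39] -/
theorem chainSumB_le_pow_div_factorial (X τ : ℝ) (n : ℕ) :
    chainSumB X τ n ≤ smallPrimesWeight X τ ^ n / n ! := by
  classical
  calc chainSumB X τ n ≤ ∑ s ∈ (smallPrimes X τ).powersetCard n, ∏ P ∈ s, ((Ideal.absNorm P : ℕ) : ℝ)⁻¹ := by
        rw [chainSumB]
        refine (sum_le_sum_of_subset_of_nonneg (filter_subset _ _) fun s _ _ => by positivity).trans_eq ?_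
        exact sum_congr rfl fun s _ => inv_absNorm_prod_eq s
    _ ≤ smallPrimesWeight X τ ^ n / n ! :=
        esymm_le_pow_div_factorial _ _ (fun _ _ => by positivity) n

/-- **`∑_{n < N} Σ₁(n) ≤ exp(W₁)`** (`∑ W₁^n/n! ≤ e^{W₁}`). [cite: HeathBrownActa2001, §6 p. 39] -/
theorem sum_chainSumB_le_exp (X τ : ℝ) (N : ℕ) :
    ∑ n ∈ range N, chainSumB X τ n ≤ Real.exp (smallPrimesWeight X τ) :=
  (sum_le_sum fun n _ => chainSumB_le_pow_div_factorial X τ n).trans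
    (Real.sum_le_exp_of_nonneg (smallPrimesWeight_nonneg X τ) N)

/-! ### Good chains (first-degree primes of distinct norms) and their count over a set of norms -/

/-- A set of prime ideals is *good* if all norms are prime and pairwise distinct (the chains of
`𝒜^(K)` are all good, Lemma 3.1; for `ℬ^(K)` the others are the tie / degree-`≥ 2` terms of p. 36
and p. 46). [cite: HeathBrownActa2001, §6 p. 36] -/
def GoodChain (s : Finset (Ideal (𝓞 K))) : Prop :=
  (∀ P ∈ s, (Ideal.absNorm P).Prime) ∧ Set.InjOn (fun P : Ideal (𝓞 K) => Ideal.absNorm P) s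

open scoped Classical in
/-- The good subsets of `𝒫₀` with a given set `t` of norms. [folklore] -/
def goodOver (X τ : ℝ) (t : Finset ℕ) : Finset (Finset (Ideal (𝓞 K))) :=
  (smallPrimes X τ).powerset.filter fun s => GoodChain s ∧ s.image (fun P => Ideal.absNorm P) = t

/-- The prime ideal factors of a product of distinct nonzero primes are its members. [folklore] -/
theorem primeFactorsFinset_prod_eq {s : Finset (Ideal (𝓞 K))} (hs : ∀ P ∈ s, P.IsPrime ∧ P ≠ ⊥) :
    primeFactorsFinset (∏ P ∈ s, P) = s := by
  have h0 : ∏ P ∈ s, P ≠ ⊥ := prod_ne_zero_iff.mpr fun P hP => (hs P hP).2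
  ext P
  rw [mem_primeFactorsFinset_iff h0]
  constructor
  · rintro ⟨hP, hPdvd⟩
    obtain ⟨Q, hQ, hQP⟩ := (hP.prod_le).mp (Ideal.le_of_dvd hPdvd)
    have := ((hs Q hQ).1.isMaximal (hs Q hQ).2).eq_of_le hP.ne_top hQP
    exact this ▸ hQ
  · intro hP
    exact ⟨(hs P hP).1, dvd_prod_of_mem _ hP⟩

/-- A product of distinct primes is square-free (a private copy of a lemma of
`FriedlanderIwaniecPrimesSquarefreeProofs`, to keep the import closure small). [folklore] -/
private theorem squarefree_prod_of_primes {t : Finset ℕ} (ht : ∀ p ∈ t, p.Prime) : Squarefree (∏ p ∈ t, p) := by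
  classical
  induction t using Finset.induction_on with
  | empty => simp
  | insert a t ha ih =>
    have ht' : ∀ p ∈ t, p.Prime := fun p hp => ht p (mem_insert_of_mem hp)
    have hap : a.Prime := ht a (mem_insert_self a t)
    rw [prod_insert ha, Nat.squarefree_mul_iff]
    refine ⟨Nat.Coprime.prod_right fun p hp => (Nat.coprime_primes hap (ht' p hp)).mpr ?_, hap.squarefree, ih ht'⟩
    rintro rfl; exact ha hp

open scoped Classical in
/-- **The good sets of prime ideals with norms `t` are as many as the ideals of norm `∏t`, namely
`∏_{p∈t} ν_p`** (`t` a set of distinct primes in `[X^τ, X^{1−τ})`): `s ↦ ∏s` is a bijection onto the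
ideals of (square-free) norm `∏t`, with inverse `R ↦` its prime ideal factors (an ideal of square-free
norm is the product of its prime factors, first-degree primes of distinct norms). This is the count
behind "each `p_i` gives rise to a corresponding prime `P_i`" in the comparison of `Σ₀` and `Σ₁`
(p. 38). [cite: HeathBrownActa2001, §6 p. 38] -/
theorem card_goodOver_eq {X τ : ℝ} {t : Finset ℕ} (ht : t ⊆ ratSmallPrimes X τ) :
    #(goodOver X τ t) = ∏ p ∈ t, cubeRootTwoCount p := by
  have htp : ∀ p ∈ t, p.Prime := fun p hp => (mem_ratSmallPrimes_iff.mp (ht hp)).1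
  have hsq : Squarefree (∏ p ∈ t, p) := squarefree_prod_of_primes htp
  rw [← idealNormCount_eq_prod_of_squarefree' htp, ← card_normEq]
  refine card_nbij' (fun s => ∏ P ∈ s, P) (fun R => primeFactorsFinset R) ?_ ?_ ?_ ?_
  · -- into `normEq (∏t)`
    intro s hs
    rw [mem_coe, goodOver, mem_filter, mem_powerset] at hs
    obtain ⟨-, ⟨-, hinj⟩, himg⟩ := hs
    rw [mem_coe, mem_normEq, absNorm_prod, ← himg, prod_image hinj]
  · -- back into `goodOver t`
    intro R hR
    rw [mem_coe, mem_normEq] at hR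
    have hRsq : Squarefree (Ideal.absNorm R) := hR ▸ hsq
    have hR0 : R ≠ ⊥ := fun h => by rw [h, Ideal.absNorm_bot] at hRsq; exact not_squarefree_zero hRsq
    have hI := normSimple_of_squarefree_absNorm hRsq
    have himg : (primeFactorsFinset R).image (fun P => Ideal.absNorm P) = t := by
      rw [hI.image_absNorm_primeFactorsFinset hR0, hR, Nat.primeFactors_prod htp]
    rw [mem_coe, goodOver, mem_filter, mem_powerset]
    refine ⟨fun P hP => ?_, ⟨fun P hP => ?_, hI.absNorm_injOn hR0⟩, himg⟩
    · obtain ⟨hPp, hPR⟩ := (mem_primeFactorsFinset_iff hR0).mp hP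
      have hP0 := ne_bot_of_mem_primeFactorsFinset hR0 hP
      have hNt : Ideal.absNorm P ∈ t := himg ▸ mem_image_of_mem _ hP
      obtain ⟨-, h1, h2⟩ := mem_ratSmallPrimes_iff.mp (ht hNt)
      exact mem_smallPrimes_iff.mpr ⟨hPp, hP0, h1, h2⟩
    · obtain ⟨hPp, hPR⟩ := (mem_primeFactorsFinset_iff hR0).mp hP
      exact (hI.prime_absNorm_and_dvd hR0 hPp hPR).1
  · -- left inverse
    intro s hs
    rw [mem_coe, goodOver, mem_filter, mem_powerset] at hs
    obtain ⟨hsub, -, -⟩ := hs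
    exact primeFactorsFinset_prod_eq fun P hP =>
      ⟨(mem_smallPrimes_iff.mp (hsub hP)).1, (mem_smallPrimes_iff.mp (hsub hP)).2.1⟩
  · -- right inverse
    intro R hR
    rw [mem_coe, mem_normEq] at hR
    have hRsq : Squarefree (Ideal.absNorm R) := hR ▸ hsq
    have hR0 : R ≠ ⊥ := fun h => by rw [h, Ideal.absNorm_bot] at hRsq; exact not_squarefree_zero hRsq
    have hI := normSimple_of_squarefree_absNorm hRsq
    have h := hI.eq_prod_filter_of_dvd hR0 (dvd_refl R) hRsq
    rw [filter_true_of_mem] at h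
    · exact h.symm
    · intro P hP
      exact Ideal.absNorm_dvd_absNorm_of_le (Ideal.le_of_dvd ((mem_primeFactorsFinset_iff hR0).mp hP).2)
where
  /-- `c_K(∏t) = ∏_{p∈t} ν_p` for a set `t` of distinct primes. [folklore] -/
  idealNormCount_eq_prod_of_squarefree' {t : Finset ℕ} (htp : ∀ p ∈ t, p.Prime) :
      idealNormCount K (∏ p ∈ t, p) = ∏ p ∈ t, cubeRootTwoCount p := by
    rw [idealNormCount_prod_primes _ htp]
    exact prod_congr rfl fun p hp => card_absNorm_eq_prime_eq_cubeRootTwoCount (htp p hp)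


/-! ### Good and bad chains; `Σ₁ = Σ₁^good + Σ₁^bad` and `Σ₁^good` as a sum over rational chains -/

open scoped Classical in
/-- The good chains of length `n`. [folklore] -/
def goodChains (X τ : ℝ) (n : ℕ) : Finset (Finset (Ideal (𝓞 K))) := (chains X τ n).filter GoodChain

open scoped Classical in
/-- The bad chains of length `n` (a member of non-prime norm, or two members of equal norm). [folklore] -/
def badChains (X τ : ℝ) (n : ℕ) : Finset (Finset (Ideal (𝓞 K))) :=
  (chains X τ n).filter fun s => ¬ GoodChain s

/-- `Σ₁^good(n)`. [folklore] -/
def chainSumBgood (X τ : ℝ) (n : ℕ) : ℝ :=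
  ∑ s ∈ goodChains X τ n, ((Ideal.absNorm (∏ P ∈ s, P) : ℕ) : ℝ)⁻¹

/-- `Σ₁^bad(n)`. [folklore] -/
def chainSumBbad (X τ : ℝ) (n : ℕ) : ℝ :=
  ∑ s ∈ badChains X τ n, ((Ideal.absNorm (∏ P ∈ s, P) : ℕ) : ℝ)⁻¹

/-- `Σ₁ = Σ₁^good + Σ₁^bad`. [folklore] -/
theorem chainSumB_eq_good_add_bad (X τ : ℝ) (n : ℕ) :
    chainSumB X τ n = chainSumBgood X τ n + chainSumBbad X τ n := by
  classical
  rw [chainSumB, chainSumBgood, chainSumBbad, goodChains, badChains, sum_filter_add_sum_filter_not]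

/-- `Σ₁^good, Σ₁^bad ≥ 0`. [folklore] -/
theorem chainSumBgood_nonneg (X τ : ℝ) (n : ℕ) : 0 ≤ chainSumBgood X τ n :=
  sum_nonneg fun _ _ => by positivity

/-- `Σ₁^bad ≥ 0`. [folklore] -/
theorem chainSumBbad_nonneg (X τ : ℝ) (n : ℕ) : 0 ≤ chainSumBbad X τ n :=
  sum_nonneg fun _ _ => by positivity

/-- `Σ₁^good ≤ Σ₁`. [folklore] -/
theorem chainSumBgood_le (X τ : ℝ) (n : ℕ) : chainSumBgood X τ n ≤ chainSumB X τ n := by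
  rw [chainSumB_eq_good_add_bad]; linarith [chainSumBbad_nonneg X τ n]

open scoped Classical in
/-- The norms of a good chain form a rational chain of the same length. [folklore] -/
theorem image_absNorm_mem_ratChains {X τ : ℝ} {n : ℕ} {s : Finset (Ideal (𝓞 K))}
    (hs : s ∈ goodChains X τ n) : s.image (fun P => Ideal.absNorm P) ∈ ratChains X τ n := by
  rw [goodChains, mem_filter, mem_chains_iff] at hs
  obtain ⟨⟨hsub, hcard, hlt⟩, hprime, hinj⟩ := hs
  rw [mem_ratChains_iff]
  refine ⟨fun p hp => ?_, by rw [card_image_of_injOn hinj, hcard], ?_⟩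
  · obtain ⟨P, hP, rfl⟩ := mem_image.mp hp
    obtain ⟨-, -, h1, h2⟩ := mem_smallPrimes_iff.mp (hsub hP)
    exact mem_ratSmallPrimes_iff.mpr ⟨hprime P hP, h1, h2⟩
  · rwa [prod_image hinj, ← absNorm_prod]

open scoped Classical in
/-- The good chains with norms `t ∈ ratChains n` are exactly `goodOver t`. [folklore] -/
theorem filter_goodChains_image_eq {X τ : ℝ} {n : ℕ} {t : Finset ℕ} (ht : t ∈ ratChains X τ n) :
    (goodChains X τ n).filter (fun s => s.image (fun P => Ideal.absNorm P) = t) = goodOver X τ t := by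
  obtain ⟨htsub, htcard, htlt⟩ := mem_ratChains_iff.mp ht
  ext s
  rw [mem_filter, goodChains, mem_filter, mem_chains_iff, goodOver, mem_filter, mem_powerset]
  constructor
  · rintro ⟨⟨⟨hsub, -, -⟩, hgood⟩, himg⟩
    exact ⟨hsub, hgood, himg⟩
  · rintro ⟨hsub, hgood, himg⟩
    have hcard : #s = n := by rw [← htcard, ← himg, card_image_of_injOn hgood.2]
    have hN : Ideal.absNorm (∏ P ∈ s, P) = ∏ p ∈ t, p := by
      rw [absNorm_prod, ← himg, prod_image hgood.2]
    exact ⟨⟨⟨hsub, hcard, by rw [hN]; exact htlt⟩, hgood⟩, himg⟩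

open scoped Classical in
/-- **`Σ₁^good(n) = ∑_{t ∈ ratChains n} (∏_{p∈t} ν_p)/∏t`**: grouping the good chains by their norms,
`∏_{p∈t} ν_p` of them above each rational chain `t` (`card_goodOver_eq`), each of weight `(∏t)^{-1}`.
[cite: HeathBrownActa2001, §6 p. 38] -/
theorem chainSumBgood_eq (X τ : ℝ) (n : ℕ) :
    chainSumBgood X τ n = ∑ t ∈ ratChains X τ n,
      (∏ p ∈ t, (cubeRootTwoCount p : ℝ)) * ((∏ p ∈ t, p : ℕ) : ℝ)⁻¹ := by
  rw [chainSumBgood, ← sum_fiberwise_of_maps_to (fun s hs => image_absNorm_mem_ratChains hs)]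
  refine sum_congr rfl fun t ht => ?_
  have htsub := (mem_ratChains_iff.mp ht).1
  have hval : ∀ s ∈ (goodChains X τ n).filter (fun s => s.image (fun P => Ideal.absNorm P) = t),
      ((Ideal.absNorm (∏ P ∈ s, P) : ℕ) : ℝ)⁻¹ = ((∏ p ∈ t, p : ℕ) : ℝ)⁻¹ := by
    intro s hs
    rw [filter_goodChains_image_eq ht, goodOver, mem_filter] at hs
    obtain ⟨-, hgood, himg⟩ := hs
    rw [absNorm_prod, ← himg, prod_image hgood.2]
  rw [sum_congr rfl hval, sum_const, filter_goodChains_image_eq ht, card_goodOver_eq htsub, nsmul_eq_mul,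
    Nat.cast_prod]

/-- **Weierstrass' inequality** `1 − ∑ εᵢ ≤ ∏ (1 − εᵢ)` for `0 ≤ εᵢ ≤ 1` (a private copy of
`Literature.NumberTheory.Sieve.CFZ.one_sub_sum_le_prod_one_sub`, `SmoothMajorantLocal`, to keep the
import closure small). [folklore] -/
private theorem one_sub_sum_le_prod_one_sub' {ι : Type*} (s : Finset ι) {ε : ι → ℝ} (h0 : ∀ i ∈ s, 0 ≤ ε i)
    (h1 : ∀ i ∈ s, ε i ≤ 1) : 1 - ∑ i ∈ s, ε i ≤ ∏ i ∈ s, (1 - ε i) := by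
  classical
  induction s using Finset.induction_on with
  | empty => simp
  | insert a s ha ih =>
    have h0' : ∀ i ∈ s, 0 ≤ ε i := fun i hi => h0 i (mem_insert_of_mem hi)
    have h1' : ∀ i ∈ s, ε i ≤ 1 := fun i hi => h1 i (mem_insert_of_mem hi)
    rw [sum_insert ha, prod_insert ha]
    have hP1 : ∏ i ∈ s, (1 - ε i) ≤ 1 := prod_le_one (fun i hi => by linarith [h1' i hi]) fun i hi => by
      linarith [h0' i hi]
    have ha0 := h0 a (mem_insert_self a s)
    nlinarith [ih h0' h1', mul_le_mul_of_nonneg_left hP1 ha0]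

/-- **`Σ₀(n) ≤ Σ₁^good(n) ≤ Σ₀(n) + n X^{-τ} Σ₁^good(n)`** (`X ≥ 1`): per rational chain,
`ρ₀(∏t)/∏t = ∏ ν_p/(p+1)` and `(∏ν_p)/∏t = ∏ ν_p/p` differ by the factor
`∏_{p∈t} p/(p+1) ≥ 1 − ∑ 1/(p+1) ≥ 1 − n X^{-τ}` — the comparison "`ρ₁(q) = ρ₀(q){1 + O(X^{-τ})}^n`"
of p. 38, in our normalisation. [cite: HeathBrownActa2001, §6 p. 38] -/
theorem chainSumA_le_chainSumBgood_and {X τ : ℝ} (hX : 1 ≤ X) (n : ℕ) :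
    chainSumA X τ n ≤ chainSumBgood X τ n ∧
      chainSumBgood X τ n ≤ chainSumA X τ n + n * (X ^ τ)⁻¹ * chainSumBgood X τ n := by
  rw [chainSumBgood_eq, chainSumA]
  have hXτ : 0 < X ^ τ := Real.rpow_pos_of_pos (by linarith) τ
  -- per chain
  have hper : ∀ t ∈ ratChains X τ n,
      densA (∏ p ∈ t, p) ≤ (∏ p ∈ t, (cubeRootTwoCount p : ℝ)) * ((∏ p ∈ t, p : ℕ) : ℝ)⁻¹ ∧
      (∏ p ∈ t, (cubeRootTwoCount p : ℝ)) * ((∏ p ∈ t, p : ℕ) : ℝ)⁻¹ ≤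
        densA (∏ p ∈ t, p) + n * (X ^ τ)⁻¹ * ((∏ p ∈ t, (cubeRootTwoCount p : ℝ)) * ((∏ p ∈ t, p : ℕ) : ℝ)⁻¹) := by
    intro t ht
    obtain ⟨htsub, htcard, -⟩ := mem_ratChains_iff.mp ht
    have htp : ∀ p ∈ t, p.Prime := fun p hp => (mem_ratSmallPrimes_iff.mp (htsub hp)).1
    have hA : densA (∏ p ∈ t, p) = ∏ p ∈ t, (cubeRootTwoCount p : ℝ) / (p + 1) := densA_prod_primes htp
    have hB : (∏ p ∈ t, (cubeRootTwoCount p : ℝ)) * ((∏ p ∈ t, p : ℕ) : ℝ)⁻¹ =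
        ∏ p ∈ t, (cubeRootTwoCount p : ℝ) / p := by
      rw [Nat.cast_prod, ← prod_inv_distrib, ← prod_mul_distrib]
      exact prod_congr rfl fun p _ => by rw [div_eq_mul_inv]
    -- `∏ ν/(p+1) = (∏ ν/p) · ∏ p/(p+1)`
    have hfac : ∏ p ∈ t, (cubeRootTwoCount p : ℝ) / (p + 1) =
        (∏ p ∈ t, (cubeRootTwoCount p : ℝ) / p) * ∏ p ∈ t, (1 - 1 / ((p : ℝ) + 1)) := by
      rw [← prod_mul_distrib]
      refine prod_congr rfl fun p hp => ?_
      have hp0 : (0 : ℝ) < p := by exact_mod_cast (htp p hp).pos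
      field_simp
      ring
    have hQ0 : 0 ≤ ∏ p ∈ t, (cubeRootTwoCount p : ℝ) / p := prod_nonneg fun p _ => by positivity
    have hR1 : ∏ p ∈ t, (1 - 1 / ((p : ℝ) + 1)) ≤ 1 :=
      prod_le_one (fun p _ => by
        have : (1 : ℝ) / (p + 1) ≤ 1 := by rw [div_le_one (by positivity)]; linarith [(p.cast_nonneg : (0:ℝ) ≤ p)]
        linarith) fun p _ => by
        have : (0 : ℝ) ≤ 1 / (p + 1) := by positivity
        linarith
    have hRlow : 1 - n * (X ^ τ)⁻¹ ≤ ∏ p ∈ t, (1 - 1 / ((p : ℝ) + 1)) := by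
      have hW := one_sub_sum_le_prod_one_sub' t (ε := fun p => 1 / ((p : ℝ) + 1))
        (fun p _ => by positivity) fun p _ => by
          rw [div_le_one (by positivity)]; linarith [(p.cast_nonneg : (0:ℝ) ≤ p)]
      refine le_trans ?_ hW
      have hsum : ∑ p ∈ t, 1 / ((p : ℝ) + 1) ≤ n * (X ^ τ)⁻¹ := by
        calc ∑ p ∈ t, 1 / ((p : ℝ) + 1) ≤ ∑ _p ∈ t, (X ^ τ)⁻¹ := by
              refine sum_le_sum fun p hp => ?_
              obtain ⟨-, h1, -⟩ := mem_ratSmallPrimes_iff.mp (htsub hp)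
              rw [one_div]
              exact inv_anti₀ hXτ (by linarith)
          _ = n * (X ^ τ)⁻¹ := by rw [sum_const, htcard, nsmul_eq_mul]
      linarith
    rw [hA, hB, hfac]
    constructor
    · exact mul_le_of_le_one_right hQ0 hR1
    · nlinarith [mul_le_mul_of_nonneg_left hRlow hQ0]
  constructor
  · exact sum_le_sum fun t ht => (hper t ht).1
  · rw [mul_sum, ← sum_add_distrib]
    exact sum_le_sum fun t ht => (hper t ht).2


/-! ### The bad chains are negligible: `Σ₁^bad(n) ≤ 6Y^{-1/3} e_{n−1} + 18 Y^{-1} e_{n−2}` -/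

/-- The elementary symmetric sums `e_k` of the weights `N(P)^{-1}` over `𝒫₀`. [folklore] -/
def esymmB (X τ : ℝ) (k : ℕ) : ℝ :=
  ∑ σ ∈ (smallPrimes X τ).powersetCard k, ∏ P ∈ σ, ((Ideal.absNorm P : ℕ) : ℝ)⁻¹

/-- `e_k ≤ W₁^k/k!`. [folklore] -/
theorem esymmB_le (X τ : ℝ) (k : ℕ) : esymmB X τ k ≤ smallPrimesWeight X τ ^ k / k ! :=
  esymm_le_pow_div_factorial _ _ (fun _ _ => by positivity) k

/-- `e_k ≥ 0`. [folklore] -/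
theorem esymmB_nonneg (X τ : ℝ) (k : ℕ) : 0 ≤ esymmB X τ k :=
  esymm_nonneg _ _ (fun _ _ => by positivity) k

open scoped Classical in
/-- **The chains with a member of non-prime norm** have total weight
`≤ (∑_{P ∈ 𝒫₀, N(P) not prime} N(P)^{-1}) · e_{n−1}` (single out such a member; `sum_sel_le`).
[cite: HeathBrownActa2001, §6 p. 36] -/
theorem sum_nonprime_chains_le (X τ : ℝ) (n : ℕ) :
    ∑ s ∈ (chains X τ (n + 1)).filter (fun s => ∃ P ∈ s, ¬ (Ideal.absNorm P).Prime),
        ((Ideal.absNorm (∏ P ∈ s, P) : ℕ) : ℝ)⁻¹ ≤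
      (∑ P ∈ (smallPrimes X τ).filter (fun P => ¬ (Ideal.absNorm P).Prime), ((Ideal.absNorm P : ℕ) : ℝ)⁻¹) *
        esymmB X τ n := by
  set A := (chains X τ (n + 1)).filter (fun s => ∃ P ∈ s, ¬ (Ideal.absNorm P).Prime) with hA
  have hAsub : A ⊆ (smallPrimes X τ).powersetCard (n + 1) := fun s hs => by
    rw [hA, mem_filter, chains, mem_filter] at hs
    exact hs.1.1
  set sel : Finset (Ideal (𝓞 K)) → Ideal (𝓞 K) := fun σ =>
    if h : ∃ P ∈ σ, ¬ (Ideal.absNorm P).Prime then h.choose else ⊥ with hsel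
  have hselmem : ∀ σ ∈ A, sel σ ∈ σ ∧ ¬ (Ideal.absNorm (sel σ)).Prime := by
    intro σ hσ
    have h : ∃ P ∈ σ, ¬ (Ideal.absNorm P).Prime := (mem_filter.mp hσ).2
    simp only [hsel, dif_pos h]
    exact h.choose_spec
  calc ∑ s ∈ A, ((Ideal.absNorm (∏ P ∈ s, P) : ℕ) : ℝ)⁻¹ = ∑ s ∈ A, ∏ P ∈ s, ((Ideal.absNorm P : ℕ) : ℝ)⁻¹ :=
        sum_congr rfl fun s _ => inv_absNorm_prod_eq s
    _ ≤ _ := by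
        refine sum_sel_le (smallPrimes X τ) _ (fun _ _ => by positivity) n A hAsub sel
          (fun σ hσ => (hselmem σ hσ).1) (fun _ P => ¬ (Ideal.absNorm P).Prime)
          (fun σ hσ => (hselmem σ hσ).2) fun σ' _ => ?_
        exact sum_le_sum_of_subset_of_nonneg (fun P hP => by
          rw [mem_filter] at hP ⊢; exact ⟨hP.1, hP.2.2⟩) fun _ _ _ => by positivity

open scoped Classical in
/-- **The chains of first-degree primes with two members of equal norm** have total weight
`≤ (∑_{P ≠ P' ∈ 𝒫₀, N(P) = N(P')} N(P)^{-1}N(P')^{-1}) · e_{n−2}` (`sum_sel₂_le`).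
[cite: HeathBrownActa2001, §6 p. 36] -/
theorem sum_tie_chains_le (X τ : ℝ) (n : ℕ) :
    ∑ s ∈ (chains X τ (n + 2)).filter (fun s : Finset (Ideal (𝓞 K)) => ¬ Set.InjOn (fun P : Ideal (𝓞 K) => Ideal.absNorm P) s),
        ((Ideal.absNorm (∏ P ∈ s, P) : ℕ) : ℝ)⁻¹ ≤
      (∑ x ∈ (smallPrimes X τ ×ˢ smallPrimes X τ).filter
          (fun x => x.1 ≠ x.2 ∧ Ideal.absNorm x.1 = Ideal.absNorm x.2),
        ((Ideal.absNorm x.1 : ℕ) : ℝ)⁻¹ * ((Ideal.absNorm x.2 : ℕ) : ℝ)⁻¹) * esymmB X τ n := by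
  set A := (chains X τ (n + 2)).filter
    (fun s : Finset (Ideal (𝓞 K)) => ¬ Set.InjOn (fun P : Ideal (𝓞 K) => Ideal.absNorm P) s) with hA
  have hAsub : A ⊆ (smallPrimes X τ).powersetCard (n + 2) := fun s hs => by
    rw [hA, mem_filter, chains, mem_filter] at hs
    exact hs.1.1
  -- a non-injective set has an ordered pair of distinct members with equal norms
  have hpair : ∀ σ ∈ A, ∃ x : Ideal (𝓞 K) × Ideal (𝓞 K), x.1 ∈ σ ∧ x.2 ∈ σ ∧ x.1 ≠ x.2 ∧
      Ideal.absNorm x.1 = Ideal.absNorm x.2 := by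
    intro σ hσ
    have h : ¬ Set.InjOn (fun P : Ideal (𝓞 K) => Ideal.absNorm P) σ := (mem_filter.mp hσ).2
    simp only [Set.InjOn, not_forall, exists_prop] at h
    obtain ⟨P, hP, P', hP', hN, hne⟩ := h
    exact ⟨(P, P'), hP, hP', hne, hN⟩
  set sel₁ : Finset (Ideal (𝓞 K)) → Ideal (𝓞 K) := fun σ =>
    if h : ∃ x : Ideal (𝓞 K) × Ideal (𝓞 K), x.1 ∈ σ ∧ x.2 ∈ σ ∧ x.1 ≠ x.2 ∧
      Ideal.absNorm x.1 = Ideal.absNorm x.2 then h.choose.1 else ⊥ with hsel₁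
  set sel₂ : Finset (Ideal (𝓞 K)) → Ideal (𝓞 K) := fun σ =>
    if h : ∃ x : Ideal (𝓞 K) × Ideal (𝓞 K), x.1 ∈ σ ∧ x.2 ∈ σ ∧ x.1 ≠ x.2 ∧
      Ideal.absNorm x.1 = Ideal.absNorm x.2 then h.choose.2 else ⊥ with hsel₂
  have hsel : ∀ σ ∈ A, sel₁ σ ∈ σ ∧ sel₂ σ ∈ σ ∧ sel₁ σ ≠ sel₂ σ ∧
      Ideal.absNorm (sel₁ σ) = Ideal.absNorm (sel₂ σ) := by
    intro σ hσ
    have h := hpair σ hσ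
    simp only [hsel₁, hsel₂, dif_pos h]
    exact h.choose_spec
  calc ∑ s ∈ A, ((Ideal.absNorm (∏ P ∈ s, P) : ℕ) : ℝ)⁻¹ = ∑ s ∈ A, ∏ P ∈ s, ((Ideal.absNorm P : ℕ) : ℝ)⁻¹ :=
        sum_congr rfl fun s _ => inv_absNorm_prod_eq s
    _ ≤ _ :=
        sum_sel₂_le (smallPrimes X τ) _ (fun _ _ => by positivity) n A hAsub sel₁ sel₂
          (fun σ hσ => (hsel σ hσ).1) (fun σ hσ => (hsel σ hσ).2.1) (fun σ hσ => (hsel σ hσ).2.2.1)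
          (fun P P' => Ideal.absNorm P = Ideal.absNorm P') (fun σ hσ => (hsel σ hσ).2.2.2) le_rfl

open scoped Classical in
/-- **`Σ₁^bad(n) ≤ 6Y^{-1/3} e_{n−1} + 18Y^{-1} e_{n−2}`** for `8 ≤ Y < X^τ` (a bad chain has a member
of non-prime norm — total weight `≤ 6/Y^{1/3}` over `𝒫₀`, `sum_inv_absNorm_nonprime_le` — or two
first-degree members of equal norm — pair weight `≤ 18/Y`, `sum_inv_absNorm_pair_eq_le`); with the
convention `e_{−1} = e_0, e_{−2} = e_0` of truncated subtraction the bound also covers `n ≤ 1`,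
where there are no bad chains of the second kind. (The paper's corresponding bounds are (6.5) and the
estimate for `T^(n)(ℬ) − T_1^(n)(ℬ)`, p. 36.) [cite: HeathBrownActa2001, §6 (6.5)] -/
theorem chainSumBbad_le {X τ Y : ℝ} (hY : 8 ≤ Y) (hYX : Y < X ^ τ) (n : ℕ) :
    chainSumBbad X τ n ≤ 6 / Y ^ (1 / 3 : ℝ) * esymmB X τ (n - 1) + 18 / Y * esymmB X τ (n - 2) := by
  have hSP : ∀ P ∈ smallPrimes X τ, P.IsPrime ∧ P ≠ ⊥ ∧ Y < (Ideal.absNorm P : ℝ) := fun P hP =>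
    ⟨(mem_smallPrimes_iff.mp hP).1, (mem_smallPrimes_iff.mp hP).2.1,
      hYX.trans_le (mem_smallPrimes_iff.mp hP).2.2.1⟩
  -- the two defect weights
  have hW1 : ∑ P ∈ (smallPrimes X τ).filter (fun P => ¬ (Ideal.absNorm P).Prime),
      ((Ideal.absNorm P : ℕ) : ℝ)⁻¹ ≤ 6 / Y ^ (1 / 3 : ℝ) :=
    sum_inv_absNorm_nonprime_le hY _ fun P hP => by
      rw [mem_filter] at hP
      exact ⟨(hSP P hP.1).1, (hSP P hP.1).2.1, hP.2, (hSP P hP.1).2.2⟩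
  have hW2 : ∑ x ∈ (smallPrimes X τ ×ˢ smallPrimes X τ).filter
      (fun x => x.1 ≠ x.2 ∧ Ideal.absNorm x.1 = Ideal.absNorm x.2),
        ((Ideal.absNorm x.1 : ℕ) : ℝ)⁻¹ * ((Ideal.absNorm x.2 : ℕ) : ℝ)⁻¹ ≤ 18 / Y :=
    sum_inv_absNorm_pair_eq_le (by linarith) _ fun x hx => by
      rw [mem_filter, mem_product] at hx
      exact ⟨(hSP _ hx.1.1).1, (hSP _ hx.1.1).2.1, (hSP _ hx.1.2).1, (hSP _ hx.1.2).2.1, hx.2.2,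
        (hSP _ hx.1.1).2.2⟩
  have h6 : 0 ≤ 6 / Y ^ (1 / 3 : ℝ) := by positivity
  have h18 : 0 ≤ 18 / Y := by positivity
  -- split the bad chains by the kind of defect
  have hsplit : chainSumBbad X τ n ≤
      ∑ s ∈ (chains X τ n).filter (fun s => ∃ P ∈ s, ¬ (Ideal.absNorm P).Prime),
          ((Ideal.absNorm (∏ P ∈ s, P) : ℕ) : ℝ)⁻¹ +
        ∑ s ∈ (chains X τ n).filter (fun s : Finset (Ideal (𝓞 K)) => ¬ Set.InjOn (fun P : Ideal (𝓞 K) => Ideal.absNorm P) s),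
          ((Ideal.absNorm (∏ P ∈ s, P) : ℕ) : ℝ)⁻¹ := by
    rw [chainSumBbad, badChains]
    refine le_trans (sum_le_sum_of_subset_of_nonneg (fun s hs => ?_) fun _ _ _ => by positivity)
      (sum_union_le_add _ _ fun _ => by positivity)
    rw [mem_filter, GoodChain, not_and_or] at hs
    rw [mem_union, mem_filter, mem_filter]
    rcases hs.2 with h | h
    · left; refine ⟨hs.1, ?_⟩; push Not at h; exact h
    · right; exact ⟨hs.1, h⟩
  refine hsplit.trans (add_le_add ?_ ?_)
  · -- first kind: needs `n ≥ 1`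
    cases n with
    | zero =>
      have hempty : (chains X τ 0).filter (fun s => ∃ P ∈ s, ¬ (Ideal.absNorm P).Prime) = ∅ := by
        rw [filter_eq_empty_iff]
        rintro s hs ⟨P, hP, -⟩
        have h0 : #s = 0 := (mem_chains_iff.mp hs).2.1
        rw [card_eq_zero] at h0
        rw [h0] at hP
        exact notMem_empty P hP
      rw [hempty, sum_empty]
      exact mul_nonneg h6 (esymmB_nonneg X τ _)
    | succ k =>
      rw [Nat.add_sub_cancel]
      exact (sum_nonprime_chains_le X τ k).trans (mul_le_mul_of_nonneg_right hW1 (esymmB_nonneg X τ k))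
  · -- second kind: needs `n ≥ 2`
    rcases Nat.lt_or_ge n 2 with hn | hn
    · have hempty : (chains X τ n).filter
          (fun s : Finset (Ideal (𝓞 K)) => ¬ Set.InjOn (fun P : Ideal (𝓞 K) => Ideal.absNorm P) s) = ∅ := by
        rw [filter_eq_empty_iff]
        intro s hs hinj
        apply hinj
        have hcard : #s = n := (mem_chains_iff.mp hs).2.1
        have : #s ≤ 1 := by omega
        exact fun a ha b hb _ => Finset.card_le_one.mp this a ha b hb
      rw [hempty, sum_empty]
      exact mul_nonneg h18 (esymmB_nonneg X τ _)
    · obtain ⟨k, rfl⟩ := Nat.exists_eq_add_of_le' hn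
      rw [Nat.add_sub_cancel]
      exact (sum_tie_chains_le X τ k).trans (mul_le_mul_of_nonneg_right hW2 (esymmB_nonneg X τ k))


/-! ### Totals over `n` -/

/-- `∑_{n<N} x^{n−1}/(n−1)! ≤ 1 + e^x` (truncated subtraction: the `n = 0` term is `1`). [folklore] -/
theorem sum_pow_pred_div_factorial_le {x : ℝ} (hx : 0 ≤ x) (N : ℕ) :
    ∑ n ∈ range N, x ^ (n - 1) / (n - 1) ! ≤ 1 + Real.exp x := by
  cases N with
  | zero => simp; positivity
  | succ N =>
    rw [sum_range_succ']
    simp only [Nat.add_sub_cancel, Nat.zero_sub, pow_zero, Nat.factorial_zero, Nat.cast_one, div_one]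
    linarith [Real.sum_le_exp_of_nonneg hx N]

/-- `∑_{n<N} x^{n−2}/(n−2)! ≤ 2 + e^x`. [folklore] -/
theorem sum_pow_pred_pred_div_factorial_le {x : ℝ} (hx : 0 ≤ x) (N : ℕ) :
    ∑ n ∈ range N, x ^ (n - 2) / (n - 2) ! ≤ 2 + Real.exp x := by
  cases N with
  | zero => simp; positivity
  | succ N =>
    rw [sum_range_succ']
    simp only [Nat.zero_sub, pow_zero, Nat.factorial_zero, Nat.cast_one, div_one]
    have h := sum_pow_pred_div_factorial_le hx N
    have : ∑ n ∈ range N, x ^ (n + 1 - 2) / (n + 1 - 2) ! = ∑ n ∈ range N, x ^ (n - 1) / (n - 1) ! :=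
      sum_congr rfl fun n _ => by rw [show n + 1 - 2 = n - 1 by omega]
    rw [this]
    linarith

/-- `∑_{n<N} n x^n/n! ≤ x e^x`. [folklore] -/
theorem sum_mul_pow_div_factorial_le {x : ℝ} (hx : 0 ≤ x) (N : ℕ) :
    ∑ n ∈ range N, n * (x ^ n / n !) ≤ x * Real.exp x := by
  cases N with
  | zero => simp; positivity
  | succ N =>
    rw [sum_range_succ']
    simp only [Nat.cast_zero, zero_mul, add_zero]
    have hterm : ∀ n ∈ range N, ((n + 1 : ℕ) : ℝ) * (x ^ (n + 1) / (n + 1) !) = x * (x ^ n / n !) := by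
      intro n _
      rw [Nat.factorial_succ, pow_succ]
      push_cast
      have : ((n : ℝ) + 1) ≠ 0 := by positivity
      field_simp
    rw [sum_congr rfl hterm, ← mul_sum]
    exact mul_le_mul_of_nonneg_left (Real.sum_le_exp_of_nonneg hx N) hx

/-- **`∑_{n<N} Σ₀(n) ≤ e^{W₁}`** (`Σ₀ ≤ Σ₁^good ≤ Σ₁`). [cite: HeathBrownActa2001, §6 p. 39] -/
theorem sum_chainSumA_le_exp {X : ℝ} (hX : 1 ≤ X) (τ : ℝ) (N : ℕ) :
    ∑ n ∈ range N, chainSumA X τ n ≤ Real.exp (smallPrimesWeight X τ) :=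
  (sum_le_sum fun n _ => ((chainSumA_le_chainSumBgood_and hX n).1.trans (chainSumBgood_le X τ n))).trans
    (sum_chainSumB_le_exp X τ N)

/-- **The chain sums of `𝒜` and `ℬ` agree**: for `X ≥ 1`, `8 ≤ Y < X^τ` and every `N`,
`∑_{n<N} |Σ₀(n) − Σ₁(n)| ≤ e^{W₁} (W₁ X^{-τ} + 12 Y^{-1/3} + 54 Y^{-1})`
(good chains: `Σ₁^good − Σ₀ ≤ nX^{-τ}Σ₁^good`, summed with `∑ nW₁^n/n! ≤ W₁e^{W₁}`; bad chains:
`chainSumBbad_le` summed with `∑ e_{n−1} ≤ 2e^{W₁}`, `∑ e_{n−2} ≤ 3e^{W₁}`). This is the estimate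
"`Σ₁ − Σ₀ ≪ Σ₀ X^{-τ/2}`"-part of p. 39 (there via `ρ₁(q) = ρ₀(q)(1 + O(X^{-τ}))^n`), in our normalisation.
[cite: HeathBrownActa2001, §6 p. 39] -/
theorem sum_abs_chainSumA_sub_chainSumB_le {X τ Y : ℝ} (hX : 1 ≤ X) (hY : 8 ≤ Y) (hYX : Y < X ^ τ) (N : ℕ) :
    ∑ n ∈ range N, |chainSumA X τ n - chainSumB X τ n| ≤
      Real.exp (smallPrimesWeight X τ) *
        (smallPrimesWeight X τ * (X ^ τ)⁻¹ + 12 / Y ^ (1 / 3 : ℝ) + 54 / Y) := by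
  set W := smallPrimesWeight X τ with hW
  have hW0 : 0 ≤ W := smallPrimesWeight_nonneg X τ
  have hXτ : 0 < X ^ τ := Real.rpow_pos_of_pos (by linarith) τ
  have hY0 : 0 < Y := by linarith
  have h6 : 0 ≤ 6 / Y ^ (1 / 3 : ℝ) := by positivity
  have h18 : 0 ≤ 18 / Y := by positivity
  -- pointwise: `|Σ₀ − Σ₁| ≤ n X^{-τ} W^n/n! + 6Y^{-1/3} e_{n-1} + 18 Y^{-1} e_{n-2}`
  have hpt : ∀ n, |chainSumA X τ n - chainSumB X τ n| ≤
      (X ^ τ)⁻¹ * (n * (W ^ n / n !)) + 6 / Y ^ (1 / 3 : ℝ) * (W ^ (n - 1) / (n - 1) !) +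
        18 / Y * (W ^ (n - 2) / (n - 2) !) := by
    intro n
    obtain ⟨h1, h2⟩ := chainSumA_le_chainSumBgood_and hX (τ := τ) n
    have h3 := chainSumB_eq_good_add_bad X τ n
    have h4 := chainSumBbad_le hY hYX n
    have h5 := chainSumBbad_nonneg X τ n
    have h6' : chainSumBgood X τ n ≤ W ^ n / n ! :=
      (chainSumBgood_le X τ n).trans (chainSumB_le_pow_div_factorial X τ n)
    have h7 := esymmB_le X τ (n - 1)
    have h8 := esymmB_le X τ (n - 2)
    rw [abs_sub_comm, abs_of_nonneg (by linarith)]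
    have hn0 : 0 ≤ (n : ℝ) * (X ^ τ)⁻¹ := by positivity
    nlinarith [mul_le_mul_of_nonneg_left h6' hn0, mul_le_mul_of_nonneg_left h7 h6,
      mul_le_mul_of_nonneg_left h8 h18]
  calc ∑ n ∈ range N, |chainSumA X τ n - chainSumB X τ n|
      ≤ ∑ n ∈ range N, ((X ^ τ)⁻¹ * (n * (W ^ n / n !)) + 6 / Y ^ (1 / 3 : ℝ) * (W ^ (n - 1) / (n - 1) !) +
          18 / Y * (W ^ (n - 2) / (n - 2) !)) := sum_le_sum fun n _ => hpt n
    _ = (X ^ τ)⁻¹ * ∑ n ∈ range N, n * (W ^ n / n !) + 6 / Y ^ (1 / 3 : ℝ) * ∑ n ∈ range N, W ^ (n - 1) / (n - 1) ! +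
          18 / Y * ∑ n ∈ range N, W ^ (n - 2) / (n - 2) ! := by
        rw [sum_add_distrib, sum_add_distrib, mul_sum, mul_sum, mul_sum]
    _ ≤ (X ^ τ)⁻¹ * (W * Real.exp W) + 6 / Y ^ (1 / 3 : ℝ) * (1 + Real.exp W) + 18 / Y * (2 + Real.exp W) := by
        gcongr
        · exact sum_mul_pow_div_factorial_le hW0 N
        · exact sum_pow_pred_div_factorial_le hW0 N
        · exact sum_pow_pred_pred_div_factorial_le hW0 N
    _ ≤ Real.exp W * (W * (X ^ τ)⁻¹ + 2 * (6 / Y ^ (1 / 3 : ℝ)) + 3 * (18 / Y)) := by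
        have hE1 : 1 ≤ Real.exp W := Real.one_le_exp hW0
        nlinarith [mul_le_mul_of_nonneg_left hE1 h6, mul_le_mul_of_nonneg_left hE1 h18]
    _ = Real.exp W * (W * (X ^ τ)⁻¹ + 12 / Y ^ (1 / 3 : ℝ) + 54 / Y) := by ring

/-! ### The size of `W₁`: `W₁ ≤ log τ^{-1} + 3` (sharp Mertens for the degree-one primes) -/

open scoped Classical in
/-- **`W₁ ≤ log(1/τ) + 3`** for `0 < τ ≤ 1/2`, `X^τ ≥ 2^{10}` and `τ log X ≥ 2C₁` (`C₁` the constant of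
the sharp Mertens window bound `exists_sum_normWt_window_le` for the degree-one primes of `K`): the
first-degree members of `𝒫₀` contribute `∑_{X^τ ≤ p < X^{1−τ}} c_K(p)/p ≤ log(2/τ) + 2C₁/(τ log X)`, the
others `≤ 6/(X^τ/2)^{1/3}` ("`Σ₁ ≪ (1/n!)(log τ^{-1} + O(1))^n`", p. 39, whose proof is this Mertens
estimate over the window `[X^τ, X^{1−τ})`). [cite: HeathBrownActa2001, §6 p. 39] -/
theorem exists_smallPrimesWeight_le :
    ∃ C₁ : ℝ, 0 ≤ C₁ ∧ ∀ X τ : ℝ, 1 < X → 0 < τ → τ ≤ 1 / 2 → (2 : ℝ) ^ 10 ≤ X ^ τ →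
      2 * C₁ ≤ τ * Real.log X → smallPrimesWeight X τ ≤ Real.log (1 / τ) + 3 := by
  obtain ⟨C₁, hC₁0, hM⟩ := exists_sum_normWt_window_le
  refine ⟨C₁, hC₁0, fun X τ hX hτ0 hτ hXτ hC => ?_⟩
  have hX0 : 0 < X := by linarith
  have hlogX : 0 < Real.log X := Real.log_pos hX
  have hτlog : Real.log (X ^ τ) = τ * Real.log X := Real.log_rpow hX0 τ
  have hXτ0 : 0 < X ^ τ := Real.rpow_pos_of_pos hX0 τ
  have h1024 : (1024 : ℝ) ≤ X ^ τ := by norm_num at hXτ; exact hXτ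
  -- `τ log X ≥ log 1024 > 6`
  have hτlog6 : 6 < τ * Real.log X := by
    rw [← hτlog]
    have : Real.log 1024 ≤ Real.log (X ^ τ) := Real.log_le_log (by norm_num) h1024
    have h2 : Real.log 1024 = 10 * Real.log 2 := by
      rw [show (1024 : ℝ) = 2 ^ 10 by norm_num, Real.log_pow]; norm_num
    linarith [Real.log_two_gt_d9]
  set lo : ℝ := X ^ τ / 2 with hlo
  set hi : ℝ := X ^ (1 - τ) with hhi
  have hlo2 : 2 ≤ lo := by rw [hlo]; linarith
  have hlohi : lo ≤ hi := by
    rw [hlo, hhi]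
    have : X ^ τ ≤ X ^ (1 - τ) := Real.rpow_le_rpow_of_exponent_le hX.le (by linarith)
    linarith [hXτ0]
  have hloglo : τ * Real.log X / 2 ≤ Real.log lo := by
    rw [hlo, Real.log_div hXτ0.ne' two_ne_zero, hτlog]
    linarith [Real.log_two_lt_d9]
  have hloglo0 : 0 < Real.log lo := by linarith
  have hloghi : Real.log hi ≤ Real.log X := by
    rw [hhi, Real.log_rpow hX0]; nlinarith
  -- split `𝒫₀` by the primality of the norm
  set SP := smallPrimes X τ with hSP
  set S₁ := SP.filter (fun P => (Ideal.absNorm P).Prime) with hS₁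
  set S₂ := SP.filter (fun P => ¬ (Ideal.absNorm P).Prime) with hS₂
  have hsplit : smallPrimesWeight X τ = ∑ P ∈ S₁, ((Ideal.absNorm P : ℕ) : ℝ)⁻¹ +
      ∑ P ∈ S₂, ((Ideal.absNorm P : ℕ) : ℝ)⁻¹ := by
    rw [smallPrimesWeight, hS₁, hS₂, sum_filter_add_sum_filter_not]
  -- the first-degree part through `c_K(p)/p`
  set T := S₁.image (fun P => Ideal.absNorm P) with hT
  have hT : ∀ p ∈ T, p.Prime ∧ lo < (p : ℝ) ∧ (p : ℝ) ≤ hi := by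
    intro p hp
    obtain ⟨P, hP, rfl⟩ := mem_image.mp hp
    rw [hS₁, mem_filter] at hP
    obtain ⟨-, -, h1, h2⟩ := mem_smallPrimes_iff.mp hP.1
    exact ⟨hP.2, by rw [hlo]; linarith, by rw [hhi]; exact h2.le⟩
  have hdeg1 : ∑ P ∈ S₁, ((Ideal.absNorm P : ℕ) : ℝ)⁻¹ ≤ ∑ p ∈ T, (idealNormCount K p : ℝ) * (p : ℝ)⁻¹ := by
    rw [sum_comp (fun p : ℕ => (p : ℝ)⁻¹) fun P => Ideal.absNorm P]
    refine sum_le_sum fun p _ => ?_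
    rw [nsmul_eq_mul]
    refine mul_le_mul_of_nonneg_right ?_ (by positivity)
    rw [← card_normEq p]
    exact_mod_cast card_le_card fun P hP => by rw [mem_normEq]; exact (mem_filter.mp hP).2
  have hMertens := hM lo hi T hlo2 hlohi hT
  -- `log(log hi/log lo) ≤ log(2/τ)`
  have hratio : Real.log (Real.log hi / Real.log lo) ≤ Real.log (1 / τ) + Real.log 2 := by
    have hhi1 : 0 < Real.log hi := by
      rw [hhi, Real.log_rpow hX0]; nlinarith
    rw [← Real.log_mul (by positivity) two_ne_zero]
    refine Real.log_le_log (div_pos hhi1 hloglo0) ?_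
    rw [div_le_iff₀ hloglo0]
    calc Real.log hi ≤ Real.log X := hloghi
      _ = 1 / τ * 2 * (τ * Real.log X / 2) := by field_simp
      _ ≤ 1 / τ * 2 * Real.log lo := mul_le_mul_of_nonneg_left hloglo (by positivity)
  have hC₁term : C₁ / Real.log lo ≤ 1 := by
    rw [div_le_one hloglo0]; linarith
  -- the degree `≥ 2` part
  have hdeg2 : ∑ P ∈ S₂, ((Ideal.absNorm P : ℕ) : ℝ)⁻¹ ≤ 6 / lo ^ (1 / 3 : ℝ) :=
    sum_inv_absNorm_nonprime_le (by linarith) _ fun P hP => by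
      rw [hS₂, mem_filter] at hP
      obtain ⟨hPp, hP0, h1, -⟩ := mem_smallPrimes_iff.mp hP.1
      exact ⟨hPp, hP0, hP.2, by rw [hlo]; linarith⟩
  have hlo3 : 6 / lo ^ (1 / 3 : ℝ) ≤ 1 := by
    have h512 : (512 : ℝ) ≤ lo := by rw [hlo]; linarith
    have h8 : (8 : ℝ) ≤ lo ^ (1 / 3 : ℝ) := by
      calc (8 : ℝ) = (512 : ℝ) ^ (1 / 3 : ℝ) := by
            rw [show (512 : ℝ) = 8 ^ (3 : ℕ) by norm_num, ← Real.rpow_natCast,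
              ← Real.rpow_mul (by norm_num)]; norm_num
        _ ≤ lo ^ (1 / 3 : ℝ) := Real.rpow_le_rpow (by norm_num) h512 (by norm_num)
    rw [div_le_one (by positivity)]; linarith
  rw [hsplit]
  linarith [Real.log_two_lt_d9]

end Literature.NumberTheory.Sieve.CubicSieve

end
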